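import Mathlib
import Summits.RiemannHypothesis.RiemannHypothesis.Theorems.IntegerScrewExitFlow
import Summits.RiemannHypothesis.RiemannHypothesis.Theorems.IntegerScrewWalkPoincareMertens
import HarnessLib

/-!
# Route `IntegerScrew` — THEOREM A's assembly: the window functional against the Dirichlet form, with the
# exit density's χ² as the one remaining analytic quantity (CONTINUUM-LIMIT §25.5)

For the all-integer atom `Ω_R` with window `W = (Q, R]` and bottom `B = [1, Q]` (harmonic weights `1/x`), the
ROOM functional of THEOREM P₀ is `⟨σ_W − σ_B, g⟩`; unnormalised, with `S_W = Σ_{Q<x≤R} 1/x`, `H_Q = Σ_{b≤Q} 1/b`,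
`c = S_W/H_Q`:  `S_W·⟨σ_W − σ_B, g⟩ = Σ_{Q<x≤R} g(x)/x − c·Σ_{b≤Q} g(b)/b`.  Split it with the exit measure
`ν_exit = exitInflow R Q` of `IntegerScrewExitFlow`:

  `Σ_W g/x − c Σ_B g/b = [Σ_W g/x − Σ_B ν_exit g]  +  [Σ_B (ν_exit(b) − c/b) g(b)]`.

The first bracket is the FLOW part (`exit_flow_cauchy_schwarz_explicit`: `≤ (A² log²R·(1/(2log²Q) − 1/(2log²R))·D(g))^{1/2}`);
the second is the RESIDUAL: since `Σ_B ν_exit = S_W = Σ_B c/b` (`sum_exitInflow_eq`) it equals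
`Σ_B (ν_exit(b) − c/b)(g(b) − g(1))`, so by Cauchy–Schwarz and the `1/L` Poincaré inequality of
`IntegerScrewWalkPoincareMertens` (second moment about `g(1)`):

* `exitChiSq R Q := Σ_{b≤Q} b·(ν_exit(b) − c/b)²` — the unnormalised χ² of the exit density (definition);
* **`exit_residual_sq_le`** — `(Σ_B (ν_exit(b) − c/b) g(b))² ≤ exitChiSq·Σ_{b≤Q}(1/b)(g(b) − g(1))²`;
* **`window_functional_sq_le`** — for `2 ≤ Q ≤ R`, the POINTWISE Green bound `Γ ≤ A log R/log x` on
  the window (`exitGamma_le`, or `IntegerScrewExitGreenSharp.exitGamma_le_sharp'` for every window) and a Mertens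
  constant `C` (`Π_{q≤p}(1−1/q)⁻¹ ≤ C log p` for primes `p ≤ R`):
  `(Σ_W g/x − c Σ_B g/b)² ≤ 2·[A² log²R(1/(2log²Q) − 1/(2log²R)) + exitChiSq·⌊log₂Q⌋·C]·D(g)`,
  `D(g) = Σ_{x≤R}(1/x)Σ_{n∣x}Λ(n)(g(x) − g(x/n))²` (PROP. 24.7 applied on the BOTTOM `Ω_Q`: `⌊log₂Q⌋`, not `⌊log₂R⌋` — gen17);
* `window_functional_sq_le_exp_five` — the same unconditionally with `C = e⁵`.

In κ-units (`κ = ε²(1−ε)log R·𝓔*`, `ε = S_W/H_R`, `D = H_R·Ẽ`) this is THEOREM A's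
`κ ≤ 2κ_F + 2κ_res`, `κ_res ≤ (1−ε)(log R/H_R)·exitChiSq·⌊log₂Q⌋·C`; the remaining analytic input of the
kernel road is the bound `exitChiSq ≲ S_W²/(H_Q·log²P)` of CONTINUUM-LIMIT 25.4 (b) (the pointwise exit-density
estimate `|r − 1| = O(1/log P)`).  RH-free, elementary.  Nothing in this file bears on the truth of RH.
References: CONTINUUM-LIMIT §25.4–25.5 (rh-explicit A6-PIVOT); M. Suzuki, J. Lond. Math. Soc. (2) 108 (2023)
1448–1487 [Suzuki2023].
-/

noncomputable section

set_option linter.dupNamespace false -- D-0017: `Summit.<S>.<S>.…` is the designed namespace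

namespace Summit.RiemannHypothesis.RiemannHypothesis.Theorems.IntegerScrew

open Finset Real
open ArithmeticFunction (vonMangoldt)

/-! ### The residual and its χ² -/

/-- The mass ratio `c = S_W/H_Q = (Σ_{Q<x≤R} 1/x)/(Σ_{b≤Q} 1/b)` (so that `Σ_{b≤Q} c/b = Σ_W 1/x = Σ_B ν_exit`).
[cite: Suzuki2023, §1 (the screw matrices S_M whose pivot/spectral theory this serves)] -/
def exitMassRatio (R Q : ℕ) : ℝ := (∑ x ∈ Ioc Q R, (1 : ℝ) / x) / ∑ b ∈ Icc 1 Q, (1 : ℝ) / b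

/-- The unnormalised χ² of the exit density against the harmonic measure on `[1, Q]`:
`Σ_{b≤Q} b·(ν_exit(b) − c/b)²`.
[cite: Suzuki2023, §1 (the screw matrices S_M whose pivot/spectral theory this serves)] -/
def exitChiSq (R Q : ℕ) : ℝ := ∑ b ∈ Icc 1 Q, (b : ℝ) * (exitInflow R Q b - exitMassRatio R Q / b) ^ 2

/-- The residual has mass zero: `Σ_{b≤Q} (ν_exit(b) − c/b) = 0` (`1 ≤ Q ≤ R`). -/
theorem sum_exitInflow_sub_eq_zero {R Q : ℕ} (hQ : 1 ≤ Q) (hQR : Q ≤ R) :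
    ∑ b ∈ Icc 1 Q, (exitInflow R Q b - exitMassRatio R Q / b) = 0 := by
  rw [Finset.sum_sub_distrib, sum_exitInflow_eq hQ hQR]
  unfold exitMassRatio
  have hH : 0 < ∑ b ∈ Icc 1 Q, (1 : ℝ) / b :=
    Finset.sum_pos (fun b hb => by have := (Finset.mem_Icc.1 hb).1; positivity) ⟨1, by simp [hQ]⟩
  have : ∑ b ∈ Icc 1 Q, (∑ x ∈ Ioc Q R, (1 : ℝ) / x) / (∑ b ∈ Icc 1 Q, (1 : ℝ) / b) / (b : ℝ) =
      ((∑ x ∈ Ioc Q R, (1 : ℝ) / x) / ∑ b ∈ Icc 1 Q, (1 : ℝ) / b) * ∑ b ∈ Icc 1 Q, (1 : ℝ) / b := by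
    rw [Finset.mul_sum]; exact Finset.sum_congr rfl fun b _ => by ring
  rw [this, div_mul_cancel₀ _ hH.ne', sub_self]

/-- **The residual against a test function, by Cauchy–Schwarz**:
`(Σ_{b≤Q} (ν_exit(b) − c/b) g(b))² ≤ exitChiSq · Σ_{b≤Q} (1/b)(g(b) − g(1))²` (`1 ≤ Q ≤ R`). -/
theorem exit_residual_sq_le {R Q : ℕ} (hQ : 1 ≤ Q) (hQR : Q ≤ R) (g : ℕ → ℝ) :
    (∑ b ∈ Icc 1 Q, (exitInflow R Q b - exitMassRatio R Q / b) * g b) ^ 2 ≤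
      exitChiSq R Q * ∑ b ∈ Icc 1 Q, (1 / (b : ℝ)) * (g b - g 1) ^ 2 := by
  -- recentre at g 1 (the residual has mass zero)
  have hre : ∑ b ∈ Icc 1 Q, (exitInflow R Q b - exitMassRatio R Q / b) * g b =
      ∑ b ∈ Icc 1 Q, (exitInflow R Q b - exitMassRatio R Q / b) * (g b - g 1) := by
    have h0 := sum_exitInflow_sub_eq_zero hQ hQR
    have : ∑ b ∈ Icc 1 Q, (exitInflow R Q b - exitMassRatio R Q / b) * (g b - g 1) =
        ∑ b ∈ Icc 1 Q, (exitInflow R Q b - exitMassRatio R Q / b) * g b -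
          g 1 * ∑ b ∈ Icc 1 Q, (exitInflow R Q b - exitMassRatio R Q / b) := by
      rw [Finset.mul_sum, ← Finset.sum_sub_distrib]
      exact Finset.sum_congr rfl fun b _ => by ring
    rw [this, h0, mul_zero, sub_zero]
  rw [hre]
  unfold exitChiSq
  refine Finset.sum_sq_le_sum_mul_sum_of_sq_le_mul (Icc 1 Q) (fun b hb => ?_) (fun b hb => ?_)
    (fun b hb => le_of_eq ?_)
  · have := (Finset.mem_Icc.1 hb).1; positivity
  · positivity
  · have hb0 : (b : ℝ) ≠ 0 := by have := (Finset.mem_Icc.1 hb).1; positivity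
    field_simp

/-! ### THEOREM A's assembly -/

/-- **THEOREM A, kernel skeleton (CONTINUUM-LIMIT §25.5).**  For `2 ≤ Q ≤ R`,
the pointwise Green bound `Γ(x) ≤ A log R/log x` on the window, a Mertens constant `C` with `Π_{q≤p}(1 − 1/q)⁻¹ ≤ C·log p` for every
prime `p ≤ R`, and every `g : ℕ → ℝ`:
`(Σ_{Q<x≤R} g(x)/x − c·Σ_{b≤Q} g(b)/b)² ≤ 2·[A² log²R·(1/(2log²Q) − 1/(2log²R)) + exitChiSq·⌊log₂Q⌋·C]·D(g)`. -/
theorem window_functional_sq_le {R Q : ℕ} (hQ : 2 ≤ Q) (hQR : Q ≤ R) {A : ℝ}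
    (hΓU : ∀ x, Q < x → x ≤ R → exitGamma R Q x ≤ A * Real.log R / Real.log x) {C : ℝ}
    (hC : ∀ p : ℕ, p.Prime → p ≤ R → ∏ q ∈ (p + 1).primesBelow, (1 - 1 / (q : ℝ))⁻¹ ≤ C * Real.log p)
    (g : ℕ → ℝ) :
    (∑ x ∈ Ioc Q R, g x / x - exitMassRatio R Q * ∑ b ∈ Icc 1 Q, g b / b) ^ 2 ≤
      2 * (A ^ 2 * Real.log R ^ 2 * (1 / (2 * Real.log Q ^ 2) - 1 / (2 * Real.log R ^ 2)) +
        exitChiSq R Q * ((Nat.log 2 Q : ℝ) * C)) *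
        ∑ x ∈ Icc 1 R, (1 / (x : ℝ)) * ∑ n ∈ x.divisors, vonMangoldt n * (g x - g (x / n)) ^ 2 := by
  have hQ1 : 1 ≤ Q := by omega
  set D := ∑ x ∈ Icc 1 R, (1 / (x : ℝ)) * ∑ n ∈ x.divisors, vonMangoldt n * (g x - g (x / n)) ^ 2 with hD
  have hDnn : 0 ≤ D := Finset.sum_nonneg fun x _ => mul_nonneg (by positivity)
    (Finset.sum_nonneg fun n _ => mul_nonneg ArithmeticFunction.vonMangoldt_nonneg (sq_nonneg _))
  -- the split
  set F := ∑ x ∈ Ioc Q R, g x / x - ∑ b ∈ Icc 1 Q, exitInflow R Q b * g b with hF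
  set Res := ∑ b ∈ Icc 1 Q, (exitInflow R Q b - exitMassRatio R Q / b) * g b with hRes
  have hsplit : ∑ x ∈ Ioc Q R, g x / x - exitMassRatio R Q * ∑ b ∈ Icc 1 Q, g b / b = F + Res := by
    simp only [hF, hRes, Finset.mul_sum]
    have : ∑ b ∈ Icc 1 Q, (exitInflow R Q b - exitMassRatio R Q / b) * g b =
        ∑ b ∈ Icc 1 Q, exitInflow R Q b * g b - ∑ b ∈ Icc 1 Q, exitMassRatio R Q * (g b / b) := by
      rw [← Finset.sum_sub_distrib]; exact Finset.sum_congr rfl fun b _ => by ring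
    rw [this]; ring
  -- the two halves
  have hFsq : F ^ 2 ≤ A ^ 2 * Real.log R ^ 2 * (1 / (2 * Real.log Q ^ 2) - 1 / (2 * Real.log R ^ 2)) * D :=
    exit_flow_cauchy_schwarz_explicit hQ hQR hΓU g
  have hRsq : Res ^ 2 ≤ exitChiSq R Q * ((Nat.log 2 Q : ℝ) * C) * D := by
    have h1 := exit_residual_sq_le hQ1 hQR g
    -- PROP. 24.7 on the BOTTOM Ω_Q (Poincaré constant ⌊log₂Q⌋·C), then D_Q ≤ D_R
    have h3 := walk_poincare_mertens_dirichlet Q g (fun r hr hrQ => hC r hr (hrQ.trans hQR))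
    have hC0 : 0 ≤ C := by
      have h := hC 2 Nat.prime_two (hQ.trans hQR)
      have h1' := one_le_prod_primesBelow_inv (2 + 1)
      have hl : 0 < Real.log 2 := Real.log_pos (by norm_num)
      nlinarith
    have h4 : ∑ x ∈ Icc 1 Q, (1 / (x : ℝ)) * ∑ n ∈ x.divisors, vonMangoldt n * (g x - g (x / n)) ^ 2 ≤ D :=
      Finset.sum_le_sum_of_subset_of_nonneg (Finset.Icc_subset_Icc_right hQR) fun x _ _ =>
        mul_nonneg (by positivity)
          (Finset.sum_nonneg fun n _ => mul_nonneg ArithmeticFunction.vonMangoldt_nonneg (sq_nonneg _))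
    have hχ : 0 ≤ exitChiSq R Q := Finset.sum_nonneg fun b hb => by
      have := (Finset.mem_Icc.1 hb).1; positivity
    have hK : 0 ≤ (Nat.log 2 Q : ℝ) * C := mul_nonneg (Nat.cast_nonneg _) hC0
    calc Res ^ 2 ≤ exitChiSq R Q * ∑ b ∈ Icc 1 Q, (1 / (b : ℝ)) * (g b - g 1) ^ 2 := h1
      _ ≤ exitChiSq R Q * (((Nat.log 2 Q : ℝ) * C) * D) :=
          mul_le_mul_of_nonneg_left (h3.trans (mul_le_mul_of_nonneg_left h4 hK)) hχ
      _ = exitChiSq R Q * ((Nat.log 2 Q : ℝ) * C) * D := by ring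
  rw [hsplit]
  -- (F + Res)² ≤ 2F² + 2Res²
  nlinarith [sq_nonneg (F - Res), hFsq, hRsq]

/-- **THEOREM A, kernel skeleton, unconditional Mertens constant `e⁵`** (`prod_primesBelow_inv_le_exp_five_mul_log`). -/
theorem window_functional_sq_le_exp_five {R Q : ℕ} (hQ : 2 ≤ Q) (hQR : Q ≤ R) {A : ℝ}
    (hΓU : ∀ x, Q < x → x ≤ R → exitGamma R Q x ≤ A * Real.log R / Real.log x) (g : ℕ → ℝ) :
    (∑ x ∈ Ioc Q R, g x / x - exitMassRatio R Q * ∑ b ∈ Icc 1 Q, g b / b) ^ 2 ≤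
      2 * (A ^ 2 * Real.log R ^ 2 * (1 / (2 * Real.log Q ^ 2) - 1 / (2 * Real.log R ^ 2)) +
        exitChiSq R Q * ((Nat.log 2 Q : ℝ) * Real.exp 5)) *
        ∑ x ∈ Icc 1 R, (1 / (x : ℝ)) * ∑ n ∈ x.divisors, vonMangoldt n * (g x - g (x / n)) ^ 2 :=
  window_functional_sq_le hQ hQR hΓU (fun _ hp _ => prod_primesBelow_inv_le_exp_five_mul_log hp) g

end Summit.RiemannHypothesis.RiemannHypothesis.Theorems.IntegerScrew

end
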